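import Literature.Algebra.Homology.OrderedCechSystemMap
import HarnessLib

/-!
# The ordered Čech complex of a system of modules, IV: base change along a ring homomorphism
# (Görtz–Wedhorn II, proof of Prop. 22.90; EGA III 6.10.5)

Sequel to `Algebra/Homology/OrderedCechSystem(Map)`: for `f : A →+* B`, a system `M` of `A`-modules, a
system `M'` of `B`-modules and `f`-semilinear maps `Θ_s : M s → M' s` compatible with the transition maps
on non-empty members,
* `SysCochain.mapₛₗ f Θ n` (componentwise `Θ`), `sysD_mapₛₗ` (it commutes with the differentials);
* the `B`-linear **cochain base change** `sysCochainBaseChange f Θ n : B ⊗_A Čⁿ(M) →ₗ[B] Čⁿ(M')`,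
  `b ⊗ g ↦ b • Θ(g)` (`sysCochainBaseChange_tmul`), bijective in every degree as soon as every
  `B ⊗_A M s → M' s`, `b ⊗ m ↦ b • Θ_s m` (`s ≠ ∅`) is (`sysCochainBaseChange_bijective`; tensor products
  commute with finite products, Mathlib `TensorProduct.piRight`), and the resulting isomorphism of complexes
  **`extendScalarsSysComplexIso : (extendScalars f)•(sysComplex M) ≅ sysComplex M'`** (`extendScalarsSysXIso_tmul`).
Elementary and proved; no named facts (Mathlib: `TensorProduct.piRight`, `ModuleCat.ExtendScalars.map_tmul`).

## References

* U. Görtz, T. Wedhorn, *Algebraic Geometry II: Cohomology of Schemes*, Springer Spektrum (2023),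
  doi:10.1007/978-3-658-43031-3: proof of Prop. 22.90 (p. 277); Def. 21.68 (p. 180). [GortzWedhorn2023]
* A. Grothendieck, EGA III₂ (Publ. Math. IHÉS 17, 1963), 6.10.5, 7.7. [EGA3]
-/

universe v u

open CategoryTheory TensorProduct

set_option backward.isDefEq.respectTransparency false

noncomputable section

namespace Literature.Algebra.Homology

namespace OrderedCech

variable {ι : Type} [LinearOrder ι] {A : Type u} [CommRing A]

/-! ### Extension of scalars along a ring homomorphism (base change of the system) -/

section BaseChange

variable {B : Type u} [CommRing B] (f : A →+* B)
variable {M : Finset ι ⥤ ModuleCat.{u} A} {M' : Finset ι ⥤ ModuleCat.{u} B}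
variable (Θ : ∀ s : Finset ι, M.obj s →ₛₗ[f] M'.obj s)
variable (hΘ : ∀ {s t : Finset ι} (_ : s.Nonempty) (h : s ⟶ t) (x : M.obj s),
  Θ t ((M.map h).hom x) = (M'.map h).hom (Θ s x))

/-- The `f`-semilinear map of cochains `Čⁿ(M) → Čⁿ(M')` induced by a compatible family of
`f`-semilinear maps `Θ_s : M s → M' s` (e.g. pull-back of sections along a base change
`Γ(W_s, 𝓛) → Γ(W'_s, 𝓛')`, Görtz–Wedhorn II, proof of Prop. 22.90). [folklore] [cite: GortzWedhorn2023, Prop. 22.90 (p. 277), proof] -/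
def SysCochain.mapₛₗ (n : ℤ) : SysCochain M n →ₛₗ[f] SysCochain M' n where
  toFun g σ := Θ σ.1 (g σ)
  map_add' g g' := by funext σ; exact map_add _ _ _
  map_smul' a g := by funext σ; exact LinearMap.map_smulₛₗ _ _ _

/-- The value of a mapped cochain. [folklore] [cite: GortzWedhorn2023, Prop. 22.90 (p. 277), proof] -/
@[simp] theorem SysCochain.mapₛₗ_apply {n : ℤ} (g : SysCochain M n) (σ : Simplex ι n) :
    SysCochain.mapₛₗ f Θ n g σ = Θ σ.1 (g σ) := rfl

include hΘ in
/-- Mapping commutes with `ext0At` (compatibility of `Θ` with the restriction maps). [folklore] [cite: GortzWedhorn2023, Prop. 22.90 (p. 277), proof] -/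
theorem SysCochain.ext0At_mapₛₗ {n : ℤ} (g : SysCochain M n) (s t : Finset ι) :
    (SysCochain.mapₛₗ f Θ n g).ext0At s t = Θ t (g.ext0At s t) := by
  unfold SysCochain.ext0At
  split_ifs with h
  · rw [SysCochain.mapₛₗ_apply, hΘ h.1.1]
  · rw [map_zero]

include hΘ in
/-- **The semilinear map of cochains commutes with the Čech differentials** (`Θ` is additive,
`Θ(ε x) = ε Θ(x)` for the signs, and compatible with restriction). [folklore] [cite: GortzWedhorn2023, Prop. 22.90 (p. 277), proof] -/
theorem sysD_mapₛₗ {n : ℤ} (g : SysCochain M n) :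
    sysD M' n (SysCochain.mapₛₗ f Θ n g) = SysCochain.mapₛₗ f Θ (n + 1) (sysD M n g) := by
  funext σ
  rw [sysD_apply, SysCochain.mapₛₗ_apply, sysD_apply, map_sum]
  refine Finset.sum_congr rfl fun a _ => ?_
  rw [SysCochain.ext0At_mapₛₗ f Θ hΘ, LinearMap.map_smulₛₗ, map_sign]

/-- **The base-change map `B ⊗_A M s → M' s`, `b ⊗ x ↦ b · Θ(x)`** (`B` an `A`-algebra through
`f`). [cite: GortzWedhorn2023, Prop. 22.90 (p. 277), proof] -/
def sysBaseChangeMap (s : Finset ι) :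
    letI := f.toAlgebra
    B ⊗[A] M.obj s →ₗ[B] M'.obj s :=
  liftₛₗ f (Θ s)

omit [LinearOrder ι] in
/-- `sysBaseChangeMap (b ⊗ x) = b · Θ(x)`. [folklore] [cite: GortzWedhorn2023, Prop. 22.90 (p. 277), proof] -/
@[simp] theorem sysBaseChangeMap_tmul (s : Finset ι) (b : B) (x : M.obj s) :
    letI := f.toAlgebra
    sysBaseChangeMap f Θ s (b ⊗ₜ[A] x) = b • Θ s x :=
  liftₛₗ_tmul f _ b x

/-- **The base-change map of cochains `B ⊗_A Čⁿ(M) → Čⁿ(M')`, `b ⊗ g ↦ b · Θ(g)`.** [folklore] [cite: GortzWedhorn2023, Prop. 22.90 (p. 277), proof] -/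
def sysCochainBaseChange (n : ℤ) :
    letI := f.toAlgebra
    B ⊗[A] SysCochain M n →ₗ[B] SysCochain M' n :=
  liftₛₗ f (SysCochain.mapₛₗ f Θ n)

/-- `sysCochainBaseChange (b ⊗ g) = b · Θ(g)`. [folklore] [cite: GortzWedhorn2023, Prop. 22.90 (p. 277), proof] -/
@[simp] theorem sysCochainBaseChange_tmul (n : ℤ) (b : B) (g : SysCochain M n) :
    letI := f.toAlgebra
    sysCochainBaseChange f Θ n (b ⊗ₜ[A] g) = b • SysCochain.mapₛₗ f Θ n g :=
  liftₛₗ_tmul f _ b g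

/-- `B ⊗_A Čⁿ(M) ≅ Π_σ B ⊗_A M σ`: tensor products commute with finite products
(Mathlib `TensorProduct.piRight`). [folklore] [cite: GortzWedhorn2023, Prop. 22.90 (p. 277), proof] -/
def sysCochainPiRight [Fintype ι] (n : ℤ) :
    letI := f.toAlgebra
    B ⊗[A] SysCochain M n ≃ₗ[B] ∀ σ : Simplex ι n, B ⊗[A] (M.obj σ.1 : Type u) :=
  letI := f.toAlgebra
  TensorProduct.piRight A B B fun τ : Simplex ι n => (M.obj τ.1 : Type u)

/-- `sysCochainPiRight (b ⊗ g) = (b ⊗ g_σ)_σ`. [folklore] [cite: GortzWedhorn2023, Prop. 22.90 (p. 277), proof] -/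
@[simp] theorem sysCochainPiRight_tmul [Fintype ι] (n : ℤ) (b : B) (g : SysCochain M n)
    (σ : Simplex ι n) :
    letI := f.toAlgebra
    sysCochainPiRight (M := M) f n (b ⊗ₜ[A] g) σ = b ⊗ₜ[A] g σ := rfl

/-- **`B ⊗_A Čⁿ(M) → Čⁿ(M')` is the product of the `B ⊗_A M s → M' s`**, after
`B ⊗_A Čⁿ(M) ≅ Π_σ B ⊗_A M σ`. [folklore] [cite: GortzWedhorn2023, Prop. 22.90 (p. 277), proof] -/
theorem sysCochainBaseChange_apply [Fintype ι] (n : ℤ) (z : letI := f.toAlgebra; B ⊗[A] SysCochain M n)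
    (σ : Simplex ι n) :
    letI := f.toAlgebra
    sysCochainBaseChange f Θ n z σ = sysBaseChangeMap f Θ σ.1 (sysCochainPiRight f n z σ) := by
  letI := f.toAlgebra
  induction z using TensorProduct.induction_on with
  | zero =>
    rw [map_zero, map_zero]
    change (0 : M'.obj σ.1) = sysBaseChangeMap f Θ σ.1 0
    rw [map_zero]
  | tmul b g =>
    rw [sysCochainBaseChange_tmul, sysCochainPiRight_tmul, sysBaseChangeMap_tmul]
    rfl
  | add x y hx hy =>
    rw [map_add, map_add]
    change sysCochainBaseChange f Θ n x σ + sysCochainBaseChange f Θ n y σ =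
      sysBaseChangeMap f Θ σ.1 (sysCochainPiRight f n x σ + sysCochainPiRight f n y σ)
    rw [map_add, hx, hy]

/-- **`B ⊗_A Čⁿ(M) → Čⁿ(M')` is bijective as soon as all `B ⊗_A M s → M' s` (`s ≠ ∅`) are.**
[folklore] [cite: GortzWedhorn2023, Prop. 22.90 (p. 277), proof] -/
theorem sysCochainBaseChange_bijective [Fintype ι]
    (hbij : ∀ s : Finset ι, s.Nonempty →
      letI := f.toAlgebra
      Function.Bijective (sysBaseChangeMap f Θ s)) (n : ℤ) :
    letI := f.toAlgebra
    Function.Bijective (sysCochainBaseChange f Θ n) := by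
  letI := f.toAlgebra
  constructor
  · intro x y hxy
    apply (sysCochainPiRight (M := M) f n).injective
    funext σ
    apply (hbij σ.1 σ.2.1).1
    rw [← sysCochainBaseChange_apply, ← sysCochainBaseChange_apply, hxy]
  · intro c
    choose w hw using fun σ : Simplex ι n => (hbij σ.1 σ.2.1).2 (c σ)
    refine ⟨(sysCochainPiRight (M := M) f n).symm w, funext fun σ => ?_⟩
    rw [sysCochainBaseChange_apply, LinearEquiv.apply_symm_apply, hw]

variable [Fintype ι]
variable (hbij : ∀ s : Finset ι, s.Nonempty →
  letI := f.toAlgebra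
  Function.Bijective (sysBaseChangeMap f Θ s))

/-- The degreewise isomorphisms `B ⊗_A Čⁿ(M) ≅ Čⁿ(M')` of `B`-modules (source: Mathlib's
`ModuleCat.extendScalars f` applied to the `n`-th term of `sysComplex M`). [folklore] [cite: GortzWedhorn2023, Prop. 22.90 (p. 277), proof] -/
def extendScalarsSysXIso (n : ℤ) :
    (ModuleCat.extendScalars f).obj ((sysComplex M).X n) ≅ (sysComplex M').X n := by
  letI := f.toAlgebra
  change ModuleCat.of B (B ⊗[A] SysCochain M n) ≅ ModuleCat.of B (SysCochain M' n)
  exact (LinearEquiv.ofBijective (sysCochainBaseChange f Θ n)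
    (sysCochainBaseChange_bijective f Θ hbij n)).toModuleIso

include hbij in
/-- The degreewise isomorphism on `b ⊗ g` is `b · Θ(g)`. [folklore] [cite: GortzWedhorn2023, Prop. 22.90 (p. 277), proof] -/
theorem extendScalarsSysXIso_hom_tmul (n : ℤ) (b : B) (g : SysCochain M n) :
    letI := f.toAlgebra
    (extendScalarsSysXIso f Θ hbij n).hom (b ⊗ₜ[A] g) = b • SysCochain.mapₛₗ f Θ n g := by
  letI := f.toAlgebra
  exact sysCochainBaseChange_tmul f Θ n b g

include hΘ in
/-- **`Č•(M) ⊗_A B ≅ Č•(M')`**: extension of scalars along `f : A → B` of the ordered Čech complex of a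
system `M` (Mathlib `ModuleCat.extendScalars f`, degreewise) is isomorphic to the ordered Čech complex of
a system `M'` over `B`, as soon as the base-change maps `B ⊗_A M s → M' s` of a compatible family of
`f`-semilinear maps are bijective — "`Č•((U_i)_i, 𝓕) ⊗_A A' ≅ Č•((u'⁻¹(U_i))_i, 𝓕')`",
Görtz–Wedhorn II, proof of Prop. 22.90. [cite: GortzWedhorn2023, Prop. 22.90 (p. 277), proof] -/
def extendScalarsSysComplexIso :
    ((ModuleCat.extendScalars f).mapHomologicalComplex (ComplexShape.up ℤ)).obj (sysComplex M) ≅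
      sysComplex M' :=
  HomologicalComplex.Hom.isoOfComponents (fun n => extendScalarsSysXIso f Θ hbij n)
    fun i j hij => by
      letI := f.toAlgebra
      have hij' : i + 1 = j := hij
      subst hij'
      rw [Functor.mapHomologicalComplex_obj_d, sysComplex_d, sysComplex_d]
      apply ModuleCat.ExtendScalars.hom_ext
      intro g
      change sysD M' i ((extendScalarsSysXIso f Θ hbij i).hom ((1 : B) ⊗ₜ[A] g)) =
        (extendScalarsSysXIso f Θ hbij (i + 1)).hom ((1 : B) ⊗ₜ[A] sysD M i g)
      rw [extendScalarsSysXIso_hom_tmul, extendScalarsSysXIso_hom_tmul, one_smul, one_smul,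
        sysD_mapₛₗ f Θ hΘ]

end BaseChange

end OrderedCech

end Literature.Algebra.Homology

end
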